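import Summits.QuantumFields.BalabanUV.Beta.D1BFx.GhostLegBlockMassD1

/-!
# `BalabanUV.Beta.D1BFx.GhostLegBlockMassD1Summed` — road «BF-x» for binder row D1, slot (K), END row `hGrp gN`, «GN-L3» PART 2a (owner ruling ρ-g9-33 (L2)∕(L3)):
# THE d1 BLOCK MASS OF THE SCALAR GHOST LEG WITH THE DIFFERENCE IN THE **SUMMED** VARIABLE,
# `Σ_{x ∈ B(β)} |Ggh n a (x+e_ρ) s − Ggh n a x s| ≤ cNear1(a)∕n · e^{−ghDelta(a)·dist(blk s, β)}`, via the ABSTRACT ENVELOPE SUMMATION behind PART 1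

HONEST DEPENDENCY (cell records, verbatim): «continuum YM on T⁴ ⇐ BetaPertH ∧ nine spine estimates (0/9 proved); BetaPertH ⇐ (D1) ∧ (D4) ∧
CAP+tail; G-an2-4 gates asym, D1 and NE2/3/4.»  HONEST FRAMING (cell contract, verbatim): «discharging `BetaPertH` makes Bałaban's UV stability
UNCONDITIONAL — a real constructive-QFT result; it is NOT the continuum limit and NOT the Clay problem.»  THIS MODULE DISCHARGES NOTHING of the wall:
[folklore] block summation of the HYPOTHESIS-FREE pointwise envelopes of `GhostLegBlockMassD1` (`abs_Ggh_le_sharp`, `abs_Ggh_diff_le_of_ne`, themselves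
corollaries of `GhostLegFree.ghost_h0 ∕ ghost_d1`, leaf-07-g3 p214847); no `def … : Prop`, no hypothesis is a printed statement, 0 binders of row D1 touched;
(K) NOT closed; NOT (CONV-C), NOT D1, NOT BetaPertH, NOT continuum, NOT Clay.

WHY (an3-g57 `HOME/b2b-balaban-beta-an3/gen57/N36-SPLIT.v1.md` §3′ (2), R-column bullet: «first differences in EITHER slot … `ghost_d1` + `Ggh_symm`»; owner
ρ-g9-33 (L2)∕(L3)).  PART 1 (`GhostLegBlockMassD1`, p259362) sums the d1 envelope over the block in the variable that is NOT differenced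
(`sum_B_abs_Ggh_diff_le`: `Σ_{t∈B(β)}|Ggh (y+e_ρ) t − Ggh y t|`, and its `Ggh_symm` twin `sum_B_abs_Ggh_diff_col_le`).  The fine-`ℓ¹` masses of the
FIRST DIFFERENCE of the R-column `ρ_s = RG(·,s)` in its running variable (`m′_ρ` of an3 §3′ (2): `Σ_x |RG(x+e,s) − RG(x,s)|`, the letter behind
`m′_row(u) ≤ w_u·m′_ρ` for the thin needles) need the OTHER block sum, `Σ_{x∈B(β)}|Ggh (x+e_ρ) s − Ggh x s|` — the difference now sits in the summed
variable.  Pointwise the envelope is the same (`abs_Ggh_diff_le_of_ne` at the pair `(x, s)`, and `|x − s|_∞ = |s − x|_∞`), so the block sum is the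
same computation; this file records that computation ONCE in abstract form and reads off both block sums.

CONTENT ([folklore]; `B = B6QGQLower276.B (n−1)`, `blk = blk (n−1)`, `Pt = Fin 4 → ℤ`, sup-metric `dist`; `[NeZero n]`, `0 < a`):
* §1 **`sum_B_le_of_envelope`** — for ANY `F : Pt → ℝ` with the diagonal value `F y ≤ 2(cG0 4 + cSplit 4 a)∕n` and the off-diagonal envelope
  `F t ≤ ghA1 a·e^{−(ghDelta a∕n)|y−t|_∞}∕(n²|y−t|_∞³)` (`t ≠ y`): `Σ_{t∈B(β)} F t ≤ cNear1 a∕n · e^{−ghDelta a·dist(blk y, β)}` (PART 1's proof, verbatim, with the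
  two uses of the ghost leg replaced by the two hypotheses: far blocks `dist ≥ 2` termwise, near blocks through `PoissonInterior.sum_cube_inv_nrm_pow_le`).
* §2 **`sum_B_abs_Ggh_diff_summed_le`** (`Σ_{x∈B(β)}|Ggh (x+e_ρ) s − Ggh x s| ≤ cNear1 a∕n·e^{−ghDelta a·dist(blk s, β)}`) and its `Ggh_symm` twin
  **`sum_B_abs_Ggh_diff_summed_row_le`** (`Σ_{t∈B(β)}|Ggh y (t+e_ρ) − Ggh y t| ≤ cNear1 a∕n·e^{−ghDelta a·dist(blk y, β)}`); for the record PART 1's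
  `sum_B_abs_Ggh_diff_le` re-derived from §1 (`sum_B_abs_Ggh_diff_le'`, same constant) — the four d1 block masses of the ghost leg now all read `cNear1∕n`.
Unit `b2b-balaban-gan24-formalise-leaf-05` (gen 41), G-an2-4 swarm leaf prover on cross-lane kernel duty; `LEAVES-BFx.md` row (N) «GN-L3» PART 2a.
-/

namespace Summit.QuantumFields.BalabanUV.Beta.D1BFx.GhostLegBlockMassD1Summed

open Finset Real
open Literature.MathematicalPhysics.QuantumFieldTheory.Balaban1983to89
open Literature.MathematicalPhysics.QuantumFieldTheory.Balaban1983to89.Beta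
open B6QGQLower276 (X e blk B mem_B)
open B6QGQDecay237 (deltaU deltaU_pos dist_blk_ge card_B)
open Beta.PoissonInterior (nrm one_le_nrm nrm_pos supNorm_eq_zero_iff cube mem_cube_zero_iff sum_cube_inv_nrm_pow_le)
open DyadicShell (Pt supNorm)
open AffineAveraging (unitVec)
open Summit.QuantumFields.BalabanUV.Beta.D1BFx.GhostLeg (Ggh Ggh_symm cast_pred_add_one)
open Summit.QuantumFields.BalabanUV.Beta.D1BFx.PointColumnSplit (cG0 cG0_nonneg cSplit cSplit_nonneg)
open Summit.QuantumFields.BalabanUV.Beta.D1BFx.GhostLegFree (ghA1 ghDelta ghDelta_pos natAbs_sub_le_blk supNorm_eq nrm_eq_supNorm)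
open Summit.QuantumFields.BalabanUV.Beta.D1BFx.GhostLegBlockMass (dist_eq_supNorm)
open Summit.QuantumFields.BalabanUV.Beta.D1BFx.GhostLegBlockMassD1 (abs_Ggh_le_sharp ghA1_nonneg abs_Ggh_diff_le_of_ne cNear1)

noncomputable section

variable (n : ℕ) [NeZero n] {a : ℝ}

/-! ## §1 The abstract envelope summation over one block -/

/-- [folklore] **THE ENVELOPE SUMMATION** (PART 1's computation, abstracted): if `F y ≤ 2(cG0 4 + cSplit 4 a)∕n` and, for `t ≠ y`,
`F t ≤ ghA1 a · e^{−(ghDelta a∕n)·|y−t|_∞} ∕ (n²·|y−t|_∞³)`, then `Σ_{t ∈ B(β)} F t ≤ cNear1 a∕n · e^{−ghDelta a·dist(blk y, β)}`. -/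
theorem sum_B_le_of_envelope (ha : 0 < a) (y β : Pt) {F : Pt → ℝ} (hdiag : F y ≤ 2 * (cG0 4 + cSplit 4 a) / n)
    (henv : ∀ t, y ≠ t → F t ≤ ghA1 a * Real.exp (-(ghDelta a / n) * supNorm (y - t)) / ((n : ℝ) ^ 2 * (supNorm (y - t) : ℝ) ^ 3)) :
    ∑ t ∈ B (n - 1) β, F t ≤ cNear1 a / n * Real.exp (-(ghDelta a * dist (blk (n - 1) y) β)) := by
  have hn : (0 : ℝ) < n := by exact_mod_cast Nat.pos_of_ne_zero (NeZero.ne n)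
  have hn1 : (1 : ℝ) ≤ n := by exact_mod_cast NeZero.one_le
  set m : ℕ := n - 1 with hm
  have hmn : ((m : ℝ) + 1) = n := cast_pred_add_one n
  set δ := ghDelta a with hδ
  have hδ0 : 0 < δ := ghDelta_pos ha
  have hA1 : 0 ≤ ghA1 a := ghA1_nonneg ha
  have hC0 : 0 ≤ cG0 4 + cSplit 4 a := add_nonneg (cG0_nonneg 4) (cSplit_nonneg 4 ha)
  set D : ℝ := dist (blk m y) β with hD
  have hD0 : 0 ≤ D := dist_nonneg
  have hy : y ∈ B m (blk m y) := mem_B.2 rfl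
  -- lower bound on the site distance from the block distance
  have hlow : ∀ t ∈ B m β, (n : ℝ) * D - m ≤ (supNorm (y - t) : ℝ) := by
    intro t ht
    have h := dist_blk_ge hy ht
    rw [hmn] at h
    rw [dist_eq_supNorm y t] at h
    exact h
  have hmle : (m : ℝ) ≤ n - 1 := by linarith
  by_cases hfar : 2 ≤ D
  · -- FAR blocks: every term ≤ ghA1·e^{δ}·e^{−δD}/n⁵, and there are n⁴ terms
    have hterm : ∀ t ∈ B m β, F t ≤ ghA1 a * Real.exp δ * Real.exp (-(δ * D)) / (n : ℝ) ^ 5 := by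
      intro t ht
      have hN := hlow t ht
      have hNn : (n : ℝ) + 1 ≤ (supNorm (y - t) : ℝ) := by nlinarith
      have hyt : y ≠ t := by
        intro h
        rw [h, sub_self] at hNn
        have : (supNorm (0 : Pt) : ℝ) = 0 := by
          rw [supNorm_eq]; exact_mod_cast (supNorm_eq_zero_iff.2 rfl)
        linarith
      have h1 := henv t hyt
      refine h1.trans ?_
      have hNpos : (0 : ℝ) < (supNorm (y - t) : ℝ) := by linarith
      rw [div_le_div_iff₀ (by positivity) (by positivity)]
      have hexp : Real.exp (-(ghDelta a / n) * supNorm (y - t)) ≤ Real.exp δ * Real.exp (-(δ * D)) := by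
        rw [← Real.exp_add]
        apply Real.exp_le_exp.2
        rw [← hδ]
        have : δ / n * ((n : ℝ) * D - m) ≤ δ / n * (supNorm (y - t) : ℝ) :=
          mul_le_mul_of_nonneg_left hN (div_nonneg hδ0.le hn.le)
        have e2 : δ / n * ((n : ℝ) * D - m) = δ * D - δ * (m / n) := by field_simp
        have e3 : δ * ((m : ℝ) / n) ≤ δ := by
          have : (m : ℝ) / n ≤ 1 := by rw [div_le_one hn]; linarith
          nlinarith
        nlinarith
      have hpoly : (n : ℝ) ^ 5 ≤ (n : ℝ) ^ 2 * (supNorm (y - t) : ℝ) ^ 3 := by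
        have : (n : ℝ) ≤ (supNorm (y - t) : ℝ) := by linarith
        have h3 : (n : ℝ) ^ 3 ≤ (supNorm (y - t) : ℝ) ^ 3 := pow_le_pow_left₀ hn.le this 3
        nlinarith [pow_pos hn 2]
      calc ghA1 a * Real.exp (-(ghDelta a / n) * supNorm (y - t)) * (n : ℝ) ^ 5
          ≤ ghA1 a * (Real.exp δ * Real.exp (-(δ * D))) * ((n : ℝ) ^ 2 * (supNorm (y - t) : ℝ) ^ 3) := by
            apply mul_le_mul (mul_le_mul_of_nonneg_left hexp hA1) hpoly (by positivity) (by positivity)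
        _ = ghA1 a * Real.exp δ * Real.exp (-(δ * D)) * ((n : ℝ) ^ 2 * (supNorm (y - t) : ℝ) ^ 3) := by ring
    calc ∑ t ∈ B m β, F t
        ≤ ∑ _t ∈ B m β, ghA1 a * Real.exp δ * Real.exp (-(δ * D)) / (n : ℝ) ^ 5 := Finset.sum_le_sum hterm
      _ = ((m : ℝ) + 1) ^ 4 * (ghA1 a * Real.exp δ * Real.exp (-(δ * D)) / (n : ℝ) ^ 5) := by
          rw [Finset.sum_const, nsmul_eq_mul, card_B]
      _ = ghA1 a * Real.exp δ / n * Real.exp (-(δ * D)) := by rw [hmn]; field_simp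
      _ ≤ cNear1 a / n * Real.exp (-(δ * D)) := by
          apply mul_le_mul_of_nonneg_right _ (Real.exp_pos _).le
          apply div_le_div_of_nonneg_right _ hn.le
          unfold cNear1
          rw [← hδ]
          have h1 : Real.exp δ ≤ Real.exp (2 * δ) := Real.exp_le_exp.2 (by linarith)
          have h2 : ghA1 a ≤ 2 * (cG0 4 + cSplit 4 a) + 433 * ghA1 a := by linarith
          exact mul_le_mul h2 h1 (Real.exp_pos _).le (by positivity)
  · -- NEAR blocks (D < 2): the diagonal pair + (ghA1/n²)·Σ_{0 < |z|_∞ ≤ 2n} |z|_∞^{-3}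
    push Not at hfar
    have hDi : ∀ i : Fin 4, ((blk m y i - β i).natAbs : ℝ) ≤ 1 := by
      intro i
      have h := dist_le_pi_dist (blk m y) β i
      rw [Int.dist_eq] at h
      have e1 : (((blk m y i - β i).natAbs : ℝ)) = |((blk m y i : ℝ) - (β i : ℝ))| := by
        rw [Nat.cast_natAbs, Int.cast_abs, Int.cast_sub]
      have h2 : ((blk m y i - β i).natAbs : ℝ) < 2 := by rw [e1]; linarith
      have h3 : (blk m y i - β i).natAbs < 2 := by exact_mod_cast h2
      have h4 : (blk m y i - β i).natAbs ≤ 1 := by omega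
      exact_mod_cast h4
    have hcube : ∀ t ∈ B m β, y - t ∈ cube (0 : Pt) (2 * n) := by
      intro t ht
      rw [mem_cube_zero_iff, Beta.PoissonInterior.supNorm, Finset.sup_le_iff]
      intro i _
      have h := natAbs_sub_le_blk m y t i
      rw [mem_B.1 ht, hmn] at h
      have h2 := hDi i
      have h3 : (((y - t) i).natAbs : ℝ) ≤ (n : ℝ) * 1 + m := by nlinarith
      have h4 : (((y - t) i).natAbs : ℝ) ≤ 2 * n := by linarith
      exact_mod_cast h4
    have hsplit : ∑ t ∈ B m β, F t ≤
        2 * (cG0 4 + cSplit 4 a) / n + ∑ t ∈ (B m β).erase y, F t := by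
      by_cases hyB : y ∈ B m β
      · rw [← Finset.add_sum_erase _ _ hyB]
        linarith [hdiag]
      · rw [Finset.erase_eq_self.2 hyB]
        have : 0 ≤ 2 * (cG0 4 + cSplit 4 a) / n := by positivity
        linarith
    have hoff : ∀ t ∈ (B m β).erase y, F t ≤ ghA1 a / (n : ℝ) ^ 2 * (1 / nrm (y - t) ^ 3) := by
      intro t ht
      rw [Finset.mem_erase] at ht
      have hyt : y ≠ t := fun h => ht.1 h.symm
      have h1 := henv t hyt
      refine h1.trans ?_
      have hv : y - t ≠ 0 := sub_ne_zero.2 hyt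
      have hnrm : nrm (y - t) = (supNorm (y - t) : ℝ) := nrm_eq_supNorm hv
      have hNpos : (0 : ℝ) < (supNorm (y - t) : ℝ) := by
        have : 0 < DyadicShell.supNorm (y - t) := DyadicShell.supNorm_pos hv
        exact_mod_cast this
      have hexp : Real.exp (-(ghDelta a / n) * supNorm (y - t)) ≤ 1 := by
        rw [Real.exp_le_one_iff]
        have : 0 ≤ ghDelta a / n * (supNorm (y - t) : ℝ) := by positivity
        linarith
      rw [hnrm]
      rw [div_le_iff₀ (by positivity)]
      calc ghA1 a * Real.exp (-(ghDelta a / n) * supNorm (y - t)) ≤ ghA1 a * 1 := mul_le_mul_of_nonneg_left hexp hA1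
        _ = ghA1 a / (n : ℝ) ^ 2 * (1 / (supNorm (y - t) : ℝ) ^ 3) * ((n : ℝ) ^ 2 * (supNorm (y - t) : ℝ) ^ 3) := by field_simp
    have hsumcube : ∑ t ∈ (B m β).erase y, (1 / nrm (y - t) ^ 3) ≤ ∑ z ∈ cube (0 : Pt) (2 * n), 1 / nrm z ^ 3 := by
      rw [← Finset.sum_image (f := fun z : Pt => 1 / nrm z ^ 3) (s := (B m β).erase y) (g := fun t => y - t)
        (fun t₁ _ t₂ _ h => by simpa using h)]
      apply Finset.sum_le_sum_of_subset_of_nonneg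
      · intro z hz
        rw [Finset.mem_image] at hz
        obtain ⟨t, ht, rfl⟩ := hz
        exact hcube t (Finset.mem_of_mem_erase ht)
      · intro z _ _
        have := nrm_pos z
        positivity
    have hcubeval : ∑ z ∈ cube (0 : Pt) (2 * n), 1 / nrm z ^ 3 ≤ 1 + 432 * (n : ℝ) := by
      have h := sum_cube_inv_nrm_pow_le (d := 4) (by norm_num) (2 * n) 3 (by norm_num)
      refine h.trans (le_of_eq ?_)
      push_cast
      norm_num
      ring
    have hoffsum : ∑ t ∈ (B m β).erase y, F t ≤ 433 * ghA1 a / n := by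
      calc ∑ t ∈ (B m β).erase y, F t
          ≤ ∑ t ∈ (B m β).erase y, ghA1 a / (n : ℝ) ^ 2 * (1 / nrm (y - t) ^ 3) := Finset.sum_le_sum hoff
        _ = ghA1 a / (n : ℝ) ^ 2 * ∑ t ∈ (B m β).erase y, (1 / nrm (y - t) ^ 3) := by rw [Finset.mul_sum]
        _ ≤ ghA1 a / (n : ℝ) ^ 2 * (1 + 432 * (n : ℝ)) := mul_le_mul_of_nonneg_left (hsumcube.trans hcubeval) (by positivity)
        _ = ghA1 a * (1 / (n : ℝ) ^ 2 + 432 / n) := by field_simp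
        _ ≤ ghA1 a * (1 / n + 432 / n) := by
            apply mul_le_mul_of_nonneg_left _ hA1
            have : 1 / (n : ℝ) ^ 2 ≤ 1 / n := one_div_le_one_div_of_le hn (by nlinarith)
            linarith
        _ = 433 * ghA1 a / n := by ring
    have htot : ∑ t ∈ B m β, F t ≤ (2 * (cG0 4 + cSplit 4 a) + 433 * ghA1 a) / n := by
      rw [add_div]; linarith
    refine htot.trans ?_
    unfold cNear1
    rw [← hδ]
    have hexp1 : 1 ≤ Real.exp (2 * δ) * Real.exp (-(δ * D)) := by
      rw [← Real.exp_add, Real.one_le_exp_iff]; nlinarith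
    have hpos : 0 ≤ (2 * (cG0 4 + cSplit 4 a) + 433 * ghA1 a) / n := by positivity
    calc (2 * (cG0 4 + cSplit 4 a) + 433 * ghA1 a) / n = (2 * (cG0 4 + cSplit 4 a) + 433 * ghA1 a) / n * 1 := (mul_one _).symm
      _ ≤ (2 * (cG0 4 + cSplit 4 a) + 433 * ghA1 a) / n * (Real.exp (2 * δ) * Real.exp (-(δ * D))) := mul_le_mul_of_nonneg_left hexp1 hpos
      _ = (2 * (cG0 4 + cSplit 4 a) + 433 * ghA1 a) * Real.exp (2 * δ) / n * Real.exp (-(δ * D)) := by ring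

/-! ## §2 The d1 block masses with the difference in the summed variable -/

/-- [folklore] The sharp diagonal pair: `|Ggh (s+e_ρ) s − Ggh s s| ≤ 2(cG0 4 + cSplit 4 a)∕n` (`abs_Ggh_le_sharp` twice, `n⁻² ≤ n⁻¹`). -/
theorem abs_Ggh_diff_diag_le (ha : 0 < a) (s : Pt) (ρ : Fin 4) :
    |Ggh n a (s + unitVec ρ) s () () - Ggh n a s s () ()| ≤ 2 * (cG0 4 + cSplit 4 a) / n := by
  have hn : (0 : ℝ) < n := by exact_mod_cast Nat.pos_of_ne_zero (NeZero.ne n)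
  have hn1 : (1 : ℝ) ≤ n := by exact_mod_cast NeZero.one_le
  have hC0 : 0 ≤ cG0 4 + cSplit 4 a := add_nonneg (cG0_nonneg 4) (cSplit_nonneg 4 ha)
  have h1 := abs_Ggh_le_sharp n ha (s + unitVec ρ) s
  have h2 := abs_Ggh_le_sharp n ha s s
  have h3 : (cG0 4 + cSplit 4 a) / (n : ℝ) ^ 2 ≤ (cG0 4 + cSplit 4 a) / n :=
    div_le_div_of_nonneg_left hC0 hn (by nlinarith)
  calc _ ≤ |Ggh n a (s + unitVec ρ) s () ()| + |Ggh n a s s () ()| := abs_sub _ _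
    _ ≤ 2 * (cG0 4 + cSplit 4 a) / n := by rw [mul_div_assoc]; linarith

/-- [folklore] `|x − s|_∞ = |s − x|_∞` as reals. -/
theorem supNorm_sub_comm (x s : Pt) : (supNorm (x - s) : ℝ) = (supNorm (s - x) : ℝ) := by
  rw [← dist_eq_supNorm, ← dist_eq_supNorm, dist_comm]

/-- [folklore] **THE SUMMED-VARIABLE d1 BLOCK MASS** (an3 §3′ (2) «first differences in EITHER slot», the `Ggh` half of `m′_ρ`):
`Σ_{x ∈ B(β)} |Ggh n a (x+e_ρ) s − Ggh n a x s| ≤ cNear1 a∕n · e^{−ghDelta a · dist(blk s, β)}`. -/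
theorem sum_B_abs_Ggh_diff_summed_le (ha : 0 < a) (s β : Pt) (ρ : Fin 4) :
    ∑ x ∈ B (n - 1) β, |Ggh n a (x + unitVec ρ) s () () - Ggh n a x s () ()|
      ≤ cNear1 a / n * Real.exp (-(ghDelta a * dist (blk (n - 1) s) β)) := by
  refine sum_B_le_of_envelope n ha s β (F := fun x => |Ggh n a (x + unitVec ρ) s () () - Ggh n a x s () ()|)
    (abs_Ggh_diff_diag_le n ha s ρ) fun x hsx => ?_
  have hxs : x ≠ s := fun h => hsx h.symm
  have h1 := abs_Ggh_diff_le_of_ne n ha hxs ρ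
  rw [supNorm_sub_comm x s] at h1
  exact h1

/-- [folklore] The `Ggh_symm` twin: `Σ_{t ∈ B(β)} |Ggh n a y (t+e_ρ) − Ggh n a y t| ≤ cNear1 a∕n · e^{−ghDelta a · dist(blk y, β)}` (difference in the summed
SECOND variable). -/
theorem sum_B_abs_Ggh_diff_summed_row_le (ha : 0 < a) (y β : Pt) (ρ : Fin 4) :
    ∑ t ∈ B (n - 1) β, |Ggh n a y (t + unitVec ρ) () () - Ggh n a y t () ()|
      ≤ cNear1 a / n * Real.exp (-(ghDelta a * dist (blk (n - 1) y) β)) := by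
  have e : ∑ t ∈ B (n - 1) β, |Ggh n a y (t + unitVec ρ) () () - Ggh n a y t () ()|
      = ∑ t ∈ B (n - 1) β, |Ggh n a (t + unitVec ρ) y () () - Ggh n a t y () ()| :=
    Finset.sum_congr rfl fun t _ => by rw [Ggh_symm n a ha y (t + unitVec ρ) () (), Ggh_symm n a ha y t () ()]
  rw [e]
  exact sum_B_abs_Ggh_diff_summed_le n ha y β ρ

/-- [folklore] For the record: PART 1's `sum_B_abs_Ggh_diff_le` is the instance `F t := |Ggh (y+e_ρ) t − Ggh y t|` of §1 (same constant). -/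
theorem sum_B_abs_Ggh_diff_le' (ha : 0 < a) (y β : Pt) (ρ : Fin 4) :
    ∑ t ∈ B (n - 1) β, |Ggh n a (y + unitVec ρ) t () () - Ggh n a y t () ()|
      ≤ cNear1 a / n * Real.exp (-(ghDelta a * dist (blk (n - 1) y) β)) :=
  sum_B_le_of_envelope n ha y β (F := fun t => |Ggh n a (y + unitVec ρ) t () () - Ggh n a y t () ()|)
    (abs_Ggh_diff_diag_le n ha y ρ) fun _ hyt => abs_Ggh_diff_le_of_ne n ha hyt ρ

end

end Summit.QuantumFields.BalabanUV.Beta.D1BFx.GhostLegBlockMassD1Summed
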